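import Literature.RingTheory.LocalCohomology.CechDropGenerator
import Mathlib.Algebra.Polynomial.Module.Basic
import Mathlib.Algebra.Polynomial.Div
import HarnessLib

/-!
# The polynomial shift: `H^{i}_{(f, y)}(E[T]) = 0` for `i < n + 1` when `H^i_{(y)}(E) = 0` for `i < n`

Topic `Literature/RingTheory/LocalCohomology`, sequel of `CechDropGenerator.lean`. Let `A` be a
commutative ring, `y_1, …, y_s ∈ A`, `E` an `A`-module with `Hⁱ_{(y)}(E) = 0` for `i < n`
(`CechVanishBelow y E n`), and `f ∈ A[T]` a MONIC polynomial. Then the polynomial module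
`E[T] = PolynomialModule A E` satisfies `Hⁱ_{(f, y_1, …, y_s)}(E[T]) = 0` for `i < n + 1`
(`CechVanishBelow.polynomialModule`). This is the base-change step
"`H^j_{(𝔪', f(T))}(R'[T], - ⊗ R'[T]) = H^1_{(f)}(H^{j-1}_{𝔪'}(-) ⊗ R'[T])`" of Česnavičius 2021,
proof of Thm. 3.13 ((punch-4)–(punch-5)), in vanishing form and without spectral sequences:

* `f` is a non-zero-divisor on `E[T]` (leading coefficients, `isSMulRegular_polynomialModule`), so by
  the peeling lemma it suffices that `Hⁱ_{(f,y)}(E[T]/fE[T]) = 0` for `i < n`;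
* `f` kills `E[T]/fE[T]`, so the generator `f` may be dropped (`CechDropGenerator.lean`), and the
  remaining family comes from `A`, so the vanishing may be computed over `A` (`CechBaseChange.lean`);
* over `A`, division by the monic `f` gives `E[T]/fE[T] ≅ E^{deg f}` (`quotSMulTopEquiv`), whose
  local cohomology vanishes below `n` with that of `E`.

Everything is proved; no named facts.

## References

* [Cesnavicius2021] K. Česnavičius, *Macaulayfication of Noetherian schemes*, Duke Math. J. 170
  (2021), proof of Thm. 3.13, (punch-4)–(punch-5).
* [Grothendieck1968SGA2] A. Grothendieck, SGA 2, Exp. II–III.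
-/

noncomputable section

universe u

namespace Literature.RingTheory.LocalCohomology

open Polynomial PolynomialModule Pointwise

variable {A : Type u} [CommRing A] {E : Type u} [AddCommGroup E] [Module A E]

/-! ## Leading coefficients in a polynomial module -/

/-- **The top coefficient of `f • q` for monic `f`**: if `q` has no coefficients above `m`, then
`(f • q)_{deg f + m} = q_m`. [folklore] -/
theorem PolynomialModule.coeff_monic_smul_natDegree_add {f : A[X]} (hf : f.Monic)
    (q : PolynomialModule A E) {m : ℕ} (hm : ∀ j, m < j → q.coeff j = 0) :
    (f • q).coeff (f.natDegree + m) = q.coeff m := by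
  rw [PolynomialModule.smul_apply, Finset.sum_eq_single (f.natDegree, m)]
  · rw [hf.coeff_natDegree, one_smul]
  · rintro ⟨i, j⟩ hij hne
    rw [Finset.mem_antidiagonal] at hij
    dsimp only at hij ⊢
    rcases lt_trichotomy m j with h | rfl | h
    · rw [hm j h, smul_zero]
    · exact absurd (Prod.ext (Nat.add_right_cancel hij) rfl : (i, m) = (f.natDegree, m)) hne
    · rw [Polynomial.coeff_eq_zero_of_natDegree_lt (by omega), zero_smul]
  · intro h
    exact absurd (Finset.mem_antidiagonal.mpr rfl :
      (f.natDegree, m) ∈ Finset.antidiagonal (f.natDegree + m)) h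

/-- A nonzero element of a polynomial module has a top coefficient. [folklore] -/
theorem PolynomialModule.exists_coeff_ne_zero_and_forall_lt {q : PolynomialModule A E}
    (hq : q ≠ 0) : ∃ m, q.coeff m ≠ 0 ∧ ∀ j, m < j → q.coeff j = 0 := by
  have hne : q.coeff.support.Nonempty := by
    rw [Finsupp.support_nonempty_iff, ne_eq, PolynomialModule.coeff_eq_zero]
    exact hq
  refine ⟨q.coeff.support.max' hne, Finsupp.mem_support_iff.mp (Finset.max'_mem _ hne),
    fun j hj => ?_⟩
  by_contra h
  exact absurd (Finset.le_max' _ j (Finsupp.mem_support_iff.mpr h)) (not_le.mpr hj)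

/-- **A monic polynomial is a non-zero-divisor on every polynomial module.** [folklore] -/
theorem isSMulRegular_polynomialModule {f : A[X]} (hf : f.Monic) :
    IsSMulRegular (PolynomialModule A E) f := by
  have key : ∀ q : PolynomialModule A E, f • q = 0 → q = 0 := by
    intro q hfq
    by_contra hq
    obtain ⟨m, hm, hlt⟩ := PolynomialModule.exists_coeff_ne_zero_and_forall_lt hq
    apply hm
    rw [← PolynomialModule.coeff_monic_smul_natDegree_add hf q hlt, hfq,
      PolynomialModule.coeff_zero, Finsupp.zero_apply]
  intro a b hab
  rw [← sub_eq_zero]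
  apply key
  rw [smul_sub, sub_eq_zero]
  exact hab

/-! ## Division by a monic polynomial: `E[T]/fE[T] ≅ E^{deg f}` -/

variable (A) in
/-- The elements of degree `< d`: `(e_0, …, e_{d-1}) ↦ Σ e_i T^i`. [folklore] -/
def PolynomialModule.lowDegree (d : ℕ) : (Fin d → E) →ₗ[A] PolynomialModule A E :=
  ∑ i : Fin d, PolynomialModule.lsingle A (i : ℕ) ∘ₗ LinearMap.proj i

/-- Coefficients of `lowDegree`, below `d`. [folklore] -/
theorem PolynomialModule.coeff_lowDegree_of_lt {d : ℕ} (e : Fin d → E) {k : ℕ} (hk : k < d) :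
    (PolynomialModule.lowDegree A d e).coeff k = e ⟨k, hk⟩ := by
  rw [PolynomialModule.lowDegree, LinearMap.sum_apply, PolynomialModule.coeff_sum,
    Finsupp.finsetSum_apply, Finset.sum_eq_single ⟨k, hk⟩]
  · simp [PolynomialModule.lsingle_apply]
  · intro i _ hi
    have : (i : ℕ) ≠ k := fun h => hi (Fin.ext h)
    simp [PolynomialModule.lsingle_apply, this]
  · intro h
    exact absurd (Finset.mem_univ _) h

/-- Coefficients of `lowDegree`, from `d` on. [folklore] -/
theorem PolynomialModule.coeff_lowDegree_of_le {d : ℕ} (e : Fin d → E) {k : ℕ} (hk : d ≤ k) :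
    (PolynomialModule.lowDegree A d e).coeff k = 0 := by
  rw [PolynomialModule.lowDegree, LinearMap.sum_apply, PolynomialModule.coeff_sum,
    Finsupp.finsetSum_apply]
  refine Finset.sum_eq_zero fun i _ => ?_
  have : (i : ℕ) ≠ k := fun h => by omega
  simp [PolynomialModule.lsingle_apply, this]

/-- `lowDegree e = 0` only for `e = 0`. [folklore] -/
theorem PolynomialModule.lowDegree_injective (d : ℕ) :
    Function.Injective (PolynomialModule.lowDegree A (E := E) d) := by
  rw [← LinearMap.ker_eq_bot, LinearMap.ker_eq_bot']
  intro e he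
  funext i
  rw [← PolynomialModule.coeff_lowDegree_of_lt (A := A) e i.2, he, PolynomialModule.coeff_zero,
    Finsupp.zero_apply, Pi.zero_apply]

/-- **Uniqueness of the remainder**: an element of degree `< deg f` divisible by the monic `f` is
zero. [folklore] -/
theorem PolynomialModule.lowDegree_eq_zero_of_mem_smul {f : A[X]} (hf : f.Monic)
    (e : Fin f.natDegree → E)
    (he : PolynomialModule.lowDegree A f.natDegree e ∈ f • (⊤ : Submodule A[X] (PolynomialModule A E))) :
    e = 0 := by
  rw [Submodule.mem_smul_pointwise_iff_exists] at he
  obtain ⟨q, -, hq⟩ := he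
  have hq0 : q = 0 := by
    by_contra hq0
    obtain ⟨m, hm, hlt⟩ := PolynomialModule.exists_coeff_ne_zero_and_forall_lt hq0
    apply hm
    rw [← PolynomialModule.coeff_monic_smul_natDegree_add hf q hlt, hq,
      PolynomialModule.coeff_lowDegree_of_le e (Nat.le_add_right _ _)]
  rw [hq0, smul_zero] at hq
  exact PolynomialModule.lowDegree_injective _ (by rw [← hq, map_zero])

/-- **Existence of the remainder for monomials**: `m T^k ≡ (T^k mod f) · m` modulo `f E[T]`,
and `(T^k mod f) · m` has degree `< deg f`. [folklore] -/
theorem PolynomialModule.exists_single_sub_lowDegree_mem {f : A[X]} (hf : f.Monic) (k : ℕ)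
    (m : E) : ∃ e : Fin f.natDegree → E, PolynomialModule.single A k m -
      PolynomialModule.lowDegree A f.natDegree e ∈ f • (⊤ : Submodule A[X] (PolynomialModule A E)) := by
  set r : A[X] := X ^ k %ₘ f with hr
  have hrcoeff : ∀ j, f.natDegree ≤ j → r.coeff j = 0 := by
    intro j hj
    by_cases h1 : f = 1
    · rw [hr, h1, Polynomial.modByMonic_one, Polynomial.coeff_zero]
    · exact Polynomial.coeff_eq_zero_of_natDegree_lt
        (lt_of_lt_of_le (Polynomial.natDegree_modByMonic_lt _ hf h1) hj)
  refine ⟨fun i => r.coeff i • m, ?_⟩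
  have hlow : PolynomialModule.lowDegree A f.natDegree (fun i => r.coeff i • m) =
      r • PolynomialModule.single A 0 m := by
    apply PolynomialModule.coeff_injective
    ext j
    rw [PolynomialModule.smul_single_apply, if_pos (Nat.zero_le j), Nat.sub_zero]
    by_cases hj : j < f.natDegree
    · rw [PolynomialModule.coeff_lowDegree_of_lt _ hj]
    · rw [PolynomialModule.coeff_lowDegree_of_le _ (not_lt.mp hj), hrcoeff j (not_lt.mp hj),
        zero_smul]
  have hsingle : PolynomialModule.single A k m = (X ^ k : A[X]) • PolynomialModule.single A 0 m := by
    rw [← Polynomial.monomial_one_right_eq_X_pow, PolynomialModule.monomial_smul_single, add_zero,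
      one_smul]
  rw [hlow, hsingle, ← Polynomial.modByMonic_add_div (X ^ k) f, add_smul, ← hr, add_sub_cancel_left,
    mul_smul]
  exact Submodule.smul_mem_pointwise_smul _ f ⊤ Submodule.mem_top

/-- **Existence of the remainder**: every element of `E[T]` is congruent modulo `fE[T]` to one of
degree `< deg f`. [folklore] -/
theorem PolynomialModule.exists_sub_lowDegree_mem {f : A[X]} (hf : f.Monic)
    (x : PolynomialModule A E) : ∃ e : Fin f.natDegree → E,
      x - PolynomialModule.lowDegree A f.natDegree e ∈ f • (⊤ : Submodule A[X] (PolynomialModule A E)) := by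
  induction x using PolynomialModule.induction_linear with
  | zero => exact ⟨0, by rw [map_zero, sub_zero]; exact Submodule.zero_mem _⟩
  | add x x' hx hx' =>
    obtain ⟨e, he⟩ := hx
    obtain ⟨e', he'⟩ := hx'
    refine ⟨e + e', ?_⟩
    rw [map_add, add_sub_add_comm]
    exact Submodule.add_mem _ he he'
  | single k m => exact PolynomialModule.exists_single_sub_lowDegree_mem hf k m

/-- The remainder map `E^{deg f} → E[T]/fE[T]` (as `A`-modules). [folklore] -/
def PolynomialModule.lowDegreeQuot (f : A[X]) :
    (Fin f.natDegree → E) →ₗ[A] QuotSMulTop f (PolynomialModule A E) :=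
  ((f • (⊤ : Submodule A[X] (PolynomialModule A E))).mkQ.restrictScalars A) ∘ₗ
    PolynomialModule.lowDegree A f.natDegree

/-- The remainder map is bijective for monic `f`. [folklore] -/
theorem PolynomialModule.lowDegreeQuot_bijective {f : A[X]} (hf : f.Monic) :
    Function.Bijective (PolynomialModule.lowDegreeQuot (A := A) (E := E) f) := by
  constructor
  · rw [← LinearMap.ker_eq_bot, LinearMap.ker_eq_bot']
    intro e he
    apply PolynomialModule.lowDegree_eq_zero_of_mem_smul hf e
    rw [PolynomialModule.lowDegreeQuot, LinearMap.comp_apply, LinearMap.restrictScalars_apply,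
      Submodule.mkQ_apply, Submodule.Quotient.mk_eq_zero] at he
    exact he
  · intro x
    induction x using Submodule.Quotient.induction_on with
    | _ x =>
      obtain ⟨e, he⟩ := PolynomialModule.exists_sub_lowDegree_mem hf x
      refine ⟨e, ?_⟩
      rw [PolynomialModule.lowDegreeQuot, LinearMap.comp_apply, LinearMap.restrictScalars_apply,
        Submodule.mkQ_apply, eq_comm, Submodule.Quotient.eq]
      exact he

/-- **Division by a monic polynomial**: `E^{deg f} ≅ E[T]/fE[T]` as `A`-modules.
[folklore] -/
def PolynomialModule.quotSMulTopEquiv {f : A[X]} (hf : f.Monic) :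
    (Fin f.natDegree → E) ≃ₗ[A] QuotSMulTop f (PolynomialModule A E) :=
  LinearEquiv.ofBijective _ (PolynomialModule.lowDegreeQuot_bijective hf)

/-! ## The polynomial shift of local cohomology vanishing -/

namespace CechVanishBelow

variable {s : ℕ} {y : Fin s → A}

/-- `f` kills `E[T]/fE[T]`. [folklore] -/
theorem smul_quotSMulTop_polynomialModule (f : A[X]) (x : QuotSMulTop f (PolynomialModule A E)) :
    f • x = 0 :=
  smul_quot f x

/-- **`Hⁱ_{(f, y)}(E[T]/fE[T]) = 0` for `i < n` if `Hⁱ_{(y)}(E) = 0` for `i < n`**, `f` monic: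
drop the generator `f` (it kills the module), compute over `A`, and use `E[T]/fE[T] ≅ E^{deg f}`.
[cite: Cesnavicius2021, proof of Thm. 3.13, (punch-4)–(punch-5)] -/
theorem quotSMulTop_polynomialModule {n : ℕ} (h : CechVanishBelow y E n) {f : A[X]} (hf : f.Monic) :
    CechVanishBelow (Fin.cons f (yB A[X] y) : Fin (s + 1) → A[X])
      (QuotSMulTop f (PolynomialModule A E)) n := by
  rw [cechVanishBelow_cons_iff_of_smul_eq_zero (smul_quotSMulTop_polynomialModule f),
    cechVanishBelow_yB_iff]
  exact (h.pi_fin f.natDegree).of_equiv (PolynomialModule.quotSMulTopEquiv hf)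

/-- **The polynomial shift** (Česnavičius 2021, proof of Thm. 3.13, (punch-4)–(punch-5), vanishing
form): if `Hⁱ_{(y_1,…,y_s)}(E) = 0` for `i < n` and `f ∈ A[T]` is monic, then
`Hⁱ_{(f, y_1, …, y_s)}(E[T]) = 0` for `i < n + 1`.
[cite: Cesnavicius2021, proof of Thm. 3.13, (punch-5)] -/
theorem polynomialModule {n : ℕ} (h : CechVanishBelow y E n) {f : A[X]} (hf : f.Monic) :
    CechVanishBelow (Fin.cons f (yB A[X] y) : Fin (s + 1) → A[X]) (PolynomialModule A E) (n + 1) :=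
  of_quotSMulTop (isSMulRegular_polynomialModule hf)
    (Ideal.le_radical (Ideal.subset_span ⟨0, rfl⟩)) (h.quotSMulTop_polynomialModule hf)

/-- The polynomial shift with the family written through `Polynomial.C`.
[cite: Cesnavicius2021, proof of Thm. 3.13, (punch-5)] -/
theorem polynomialModule' {n : ℕ} (h : CechVanishBelow y E n) {f : A[X]} (hf : f.Monic) :
    CechVanishBelow (Fin.cons f (fun i => C (y i)) : Fin (s + 1) → A[X]) (PolynomialModule A E)
      (n + 1) := by
  have : (fun i => C (y i)) = yB A[X] y := funext fun i => (Polynomial.algebraMap_apply (y i)).symm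
  rw [this]
  exact h.polynomialModule hf

end CechVanishBelow

end Literature.RingTheory.LocalCohomology

end
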